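import Literature.AlgebraicGeometry.Resolution.ExcellentRingsProofs
import Mathlib.RingTheory.AdicCompletion.LocalRing
import Mathlib.RingTheory.Localization.AtPrime.Basic
import Mathlib.RingTheory.Localization.Away.Basic
import Mathlib.RingTheory.Localization.BaseChange
import Mathlib.RingTheory.LocalRing.ResidueField.Ideal
import Mathlib.RingTheory.TensorProduct.Basic
import HarnessLib

/-!
# Artin approximation over an affine base: lemmas

Topic: `Literature/AlgebraicGeometry/Resolution`. Elementary lemmas for the proof of the affine
(ring-theoretic) form of Artin's approximation theorem over étale neighbourhoods (Artin 1969,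
Cor. 2.1; Stacks 07QZ) from Popescu's theorem and Stacks 07M7
(`ArtinApproximationAffine.lean`). Everything here is PROVED; no new notions.

* `isRegularRing_of_subsingleton`, `IsGeometricallyRegular.of_subsingleton` — the zero ring.
* `IsRegularHom.comp_isLocalization` — if `R = M⁻¹B` and `R → Λ` is a regular homomorphism
  then so is `B → Λ` (the fibre over `𝔮` is the fibre of `R → Λ` over `𝔮R` if `𝔮 ∩ M = ∅`,
  and is zero otherwise).
* `IsGRing.isRegularHom_completion_of_isLocalization_atPrime` — for a G-ring `B`, a prime `𝔭`
  and any localisation `R` of `B` at `𝔭`, both `R → R^` and `B → R^` are regular.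
* `AdicCompletion.sub_of_mem_pow_map_of_evalₐ_eq` — if `x ∈ R^` and `a ∈ R` have the same
  image in `R/Iⁿ` then `x - a ∈ Iⁿ R^` (`I` finitely generated).
* `residue_away_eq_zero_iff`, `exists_away_section` — for `t ∉ 𝔭` the kernel of
  `B_t → R → κ(𝔭)` is `𝔭B_t`; a `B`-algebra map `χ : C → κ(𝔭)` from a finitely generated
  `B`-algebra descends, for a common denominator `t ∉ 𝔭` of its values on generators, to a
  `B_t`-algebra map `B_t ⊗_B C → B_t/𝔭B_t` (the shrinking of the affine neighbourhood that lets
  Stacks 07M7 be applied over the base `B_t` with the ideal `𝔭B_t`).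

[cite: StacksProject, Tag 07QZ (proof)]
-/

noncomputable section

open IsLocalRing TensorProduct

namespace Literature.AlgebraicGeometry.Resolution

universe u

/-! ## The zero ring is regular -/

/-- The zero ring is a regular ring (Noetherian, and it has no primes). [folklore] -/
theorem isRegularRing_of_subsingleton (A : Type u) [CommRing A] [Subsingleton A] :
    IsRegularRing A := by
  haveI : IsNoetherianRing A := inferInstance
  refine ⟨fun p hp => ?_⟩
  exact absurd (Subsingleton.elim p ⊤) hp.ne_top

/-- The zero algebra is geometrically regular over any field. [folklore] -/
theorem IsGeometricallyRegular.of_subsingleton (k A : Type u) [Field k] [CommRing A] [Algebra k A]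
    [Subsingleton A] : IsGeometricallyRegular k A := by
  intro k' _ _ _
  haveI : Subsingleton (k' ⊗[k] A) := by
    refine subsingleton_of_zero_eq_one ?_
    have h1 : (1 : k' ⊗[k] A) = (1 : k') ⊗ₜ[k] (1 : A) := rfl
    rw [h1, Subsingleton.elim (1 : A) 0, TensorProduct.tmul_zero]
  exact isRegularRing_of_subsingleton _

/-! ## Regular homomorphisms and localisation of the source -/

section CompLocalization

variable {B : Type u} [CommRing B]

/-- The fibre of `B → Λ` over a prime `𝔮` of `B` meeting `M` is zero, when `B → Λ` factors
through `R = M⁻¹B`. [folklore] -/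
theorem subsingleton_fibre_of_not_disjoint (M : Submonoid B) (R Λ : Type u) [CommRing R]
    [CommRing Λ] [Algebra B R] [IsLocalization M R] [Algebra R Λ] [Algebra B Λ] [IsScalarTower B R Λ]
    (q : Ideal B) [q.IsPrime] (hq : ¬ Disjoint (M : Set B) (q : Set B)) :
    Subsingleton (q.ResidueField ⊗[B] Λ) := by
  rw [Set.not_disjoint_iff] at hq
  obtain ⟨s, hsM, hsq⟩ := hq
  have hu : IsUnit (algebraMap B Λ s) := by
    rw [IsScalarTower.algebraMap_apply B R Λ]
    exact (IsLocalization.map_units R ⟨s, hsM⟩).map _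
  obtain ⟨u, hu'⟩ := hu.exists_right_inv
  refine subsingleton_of_zero_eq_one ?_
  have h1 : (1 : q.ResidueField ⊗[B] Λ) = (1 : q.ResidueField) ⊗ₜ[B] (1 : Λ) := rfl
  have hs0 : algebraMap B q.ResidueField s = 0 := by
    rw [Ideal.algebraMap_residueField_eq_zero]
    exact hsq
  rw [h1, ← hu', ← Algebra.smul_def, ← TensorProduct.smul_tmul, Algebra.smul_def, mul_one, hs0,
    TensorProduct.zero_tmul]

/-- **Regularity is insensitive to localising the source.** If `R = M⁻¹B` and the `R`-algebra
`Λ` is regular over `R` (flat, geometrically regular fibres), then `Λ` is regular over `B`: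
`B → R` is flat; the fibre over a prime `𝔮` disjoint from `M` is the fibre of `R → Λ` over
`𝔮R` (same residue field, `L ⊗_R Λ = L ⊗_B Λ`), and the fibre over a prime meeting `M` is
zero. [folklore] -/
theorem IsRegularHom.comp_isLocalization (M : Submonoid B) (R Λ : Type u) [CommRing R]
    [CommRing Λ] [Algebra B R] [IsLocalization M R] [Algebra R Λ] [Algebra B Λ] [IsScalarTower B R Λ]
    (h : IsRegularHom R Λ) : IsRegularHom B Λ := by
  haveI : Module.Flat R Λ := h.1
  haveI : Module.Flat B R := IsLocalization.flat R M
  refine ⟨Module.Flat.trans B R Λ, fun q _ => ?_⟩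
  by_cases hd : Disjoint (M : Set B) (q : Set B)
  swap
  · haveI := subsingleton_fibre_of_not_disjoint M R Λ q hd
    exact IsGeometricallyRegular.of_subsingleton _ _
  -- the prime `Q = 𝔮R` of `R` over `𝔮`
  set Q : Ideal R := q.map (algebraMap B R) with hQdef
  haveI hQ : Q.IsPrime := IsLocalization.isPrime_of_isPrime_disjoint M R q ‹_› hd
  have hqQ : q = Q.comap (algebraMap B R) := by
    rw [← Ideal.under_def]
    exact (IsLocalization.under_map_of_isPrime_disjoint M R ‹q.IsPrime› hd).symm
  have H : IsGeometricallyRegular Q.ResidueField (Q.ResidueField ⊗[R] Λ) := h.2 Q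
  intro L _ _ hL
  haveI := hL
  let ρ : q.ResidueField →+* Q.ResidueField := Ideal.ResidueField.map q Q (algebraMap B R) hqQ
  have hρ : Function.Bijective ρ :=
    (RingHom.surjectiveOnStalks_of_isLocalization M R).residueFieldMap_bijective q Q hqQ
  let e : q.ResidueField ≃+* Q.ResidueField := RingEquiv.ofBijective ρ hρ
  letI : Algebra Q.ResidueField L := ((algebraMap q.ResidueField L).comp e.symm.toRingHom).toAlgebra
  haveI : Module.Finite Q.ResidueField L := by
    have h₁ : (algebraMap q.ResidueField L).Finite := RingHom.finite_algebraMap.mpr hL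
    have h₂ : e.symm.toRingHom.Finite := RingHom.Finite.of_surjective _ e.symm.surjective
    exact RingHom.finite_algebraMap.mp (h₁.comp h₂)
  haveI : IsRegularRing (L ⊗[Q.ResidueField] (Q.ResidueField ⊗[R] Λ)) := H L inferInstance
  letI : Algebra R L := ((algebraMap Q.ResidueField L).comp (algebraMap R Q.ResidueField)).toAlgebra
  haveI : IsScalarTower R Q.ResidueField L := IsScalarTower.of_algebraMap_eq fun _ => rfl
  letI : Algebra B L := ((algebraMap R L).comp (algebraMap B R)).toAlgebra
  haveI : IsScalarTower B R L := IsScalarTower.of_algebraMap_eq fun _ => rfl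
  haveI : IsScalarTower B q.ResidueField L := by
    refine IsScalarTower.of_algebraMap_eq fun b => ?_
    change algebraMap Q.ResidueField L (algebraMap R Q.ResidueField (algebraMap B R b)) =
      algebraMap q.ResidueField L (algebraMap B q.ResidueField b)
    have hb : e (algebraMap B q.ResidueField b) = algebraMap R Q.ResidueField (algebraMap B R b) := by
      change ρ (algebraMap B q.ResidueField b) = _
      rw [Ideal.ResidueField.map_algebraMap]
    rw [← hb]
    change algebraMap q.ResidueField L (e.symm (e _)) = _
    rw [RingEquiv.symm_apply_apply]
  let e₁ : L ⊗[Q.ResidueField] (Q.ResidueField ⊗[R] Λ) ≃ₐ[L] L ⊗[R] Λ :=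
    Algebra.TensorProduct.cancelBaseChange R Q.ResidueField L L Λ
  let e₂ : L ⊗[R] Λ ≃ₐ[R] L ⊗[B] Λ := IsLocalization.algebraTensorEquiv M R L Λ
  let e₃ : L ⊗[q.ResidueField] (q.ResidueField ⊗[B] Λ) ≃ₐ[L] L ⊗[B] Λ :=
    Algebra.TensorProduct.cancelBaseChange B q.ResidueField L L Λ
  have e' : L ⊗[Q.ResidueField] (Q.ResidueField ⊗[R] Λ) ≃+*
      L ⊗[q.ResidueField] (q.ResidueField ⊗[B] Λ) :=
    (e₁.toRingEquiv.trans e₂.toRingEquiv).trans e₃.symm.toRingEquiv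
  exact IsRegularRing.of_ringEquiv
    (R := L ⊗[Q.ResidueField] (Q.ResidueField ⊗[R] Λ)) e'

end CompLocalization

/-! ## G-rings: regularity of `B → (B_𝔭)^` for any localisation at `𝔭` -/

section GRing

variable {B : Type u} [CommRing B]

/-- For a G-ring `B` and ANY localisation `R` of `B` at a prime `𝔭` (not just the model
`Localization.AtPrime 𝔭`), the completion map `R → R^` is a regular homomorphism (transport
along the `B`-isomorphism `B_𝔭 ≅ R`). [cite: Matsumura1987, §32 p. 256] -/
theorem IsGRing.isRegularHom_completion_of_isLocalization_atPrime (hB : IsGRing B) (p : Ideal B)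
    [p.IsPrime] (R : Type u) [CommRing R] [IsLocalRing R] [Algebra B R] [IsLocalization.AtPrime R p] :
    IsRegularHom R (AdicCompletion (maximalIdeal R) R) := by
  haveI : IsNoetherianRing B := hB.1
  haveI : IsNoetherianRing R := IsLocalization.isNoetherianRing p.primeCompl R inferInstance
  let e : Localization.AtPrime p ≃ₐ[B] R := IsLocalization.algEquiv p.primeCompl _ _
  letI : Algebra (Localization.AtPrime p) R := e.toAlgHom.toRingHom.toAlgebra
  exact IsRegularHom.completion_of_surjective e.surjective (hB.2 p)

/-- For a G-ring `B` and any localisation `R` of `B` at a prime `𝔭`, the composite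
`B → R → R^` is a regular homomorphism. [cite: Matsumura1987, §32 p. 256] -/
theorem IsGRing.isRegularHom_comp_completion (hB : IsGRing B) (p : Ideal B) [p.IsPrime]
    (R : Type u) [CommRing R] [IsLocalRing R] [Algebra B R] [IsLocalization.AtPrime R p] :
    IsRegularHom B (AdicCompletion (maximalIdeal R) R) :=
  haveI : IsScalarTower B R (AdicCompletion (maximalIdeal R) R) :=
    IsScalarTower.of_algebraMap_eq fun _ => rfl
  IsRegularHom.comp_isLocalization p.primeCompl R (AdicCompletion (maximalIdeal R) R)
    (IsGRing.isRegularHom_completion_of_isLocalization_atPrime hB p R)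

end GRing

/-! ## Adic completions: congruences -/

/-- If `x ∈ R^_I` and `a ∈ R` have the same image in `R/Iⁿ` (`I` finitely generated), then
`x - a ∈ Iⁿ R^`. [folklore] -/
theorem AdicCompletion.sub_of_mem_pow_map_of_evalₐ_eq {R : Type u} [CommRing R] (I : Ideal R)
    (hI : I.FG) {n : ℕ} (x : AdicCompletion I R) (a : R)
    (h : AdicCompletion.evalₐ I n x = Ideal.Quotient.mk (I ^ n) a) :
    x - AdicCompletion.of I R a ∈ (I.map (algebraMap R (AdicCompletion I R))) ^ n := by
  have hle : I ^ n ≤ I ^ n • ⊤ := le_of_eq (by simp [Ideal.mul_top])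
  have hker : x - AdicCompletion.of I R a ∈ LinearMap.ker (AdicCompletion.eval I R n) := by
    rw [LinearMap.mem_ker, map_sub, sub_eq_zero,
      ← AdicCompletion.factor_evalₐ_eq_eval I x hle,
      ← AdicCompletion.factor_evalₐ_eq_eval I (AdicCompletion.of I R a) hle, h,
      AdicCompletion.evalₐ_of]
  rw [← AdicCompletion.pow_smul_top_eq_ker_eval hI, Ideal.smul_top_eq_map,
    Submodule.restrictScalars_mem, Ideal.map_pow] at hker
  exact hker

/-! ## Sections over the residue field descend to `B_t / 𝔭 B_t`

If `C` is a finitely generated `B`-algebra with a `B`-algebra map `χ : C → κ(𝔭)` into the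
residue field of a localisation `R` of `B` at `𝔭`, then for a suitable `t ∉ 𝔭` (a common
denominator of the values of `χ` on generators) the base change `B_t ⊗_B C` has a `B_t`-algebra
map to `B_t / 𝔭B_t ⊆ κ(𝔭)`. This is the "shrinking of the affine neighbourhood" that lets
Stacks 07M7 be applied over the non-local base `B_t` with the ideal `𝔭 B_t`. -/

section AwaySection

variable {B : Type u} [CommRing B] (p : Ideal B) [p.IsPrime]
  (R : Type u) [CommRing R] [IsLocalRing R] [Algebra B R] [IsLocalization.AtPrime R p]

/-- The kernel of `B_t → R → κ(𝔭)` is `𝔭 B_t`, for `t ∉ 𝔭` and any `B`-algebra map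
`ψ : B_t → R` to a localisation `R` of `B` at `𝔭`. [folklore] -/
theorem residue_away_eq_zero_iff (t : B) (ht : t ∉ p) (ψ : Localization.Away t →ₐ[B] R)
    (x : Localization.Away t) :
    residue R (ψ x) = 0 ↔ x ∈ p.map (algebraMap B (Localization.Away t)) := by
  obtain ⟨⟨b, w⟩, rfl⟩ := IsLocalization.mk'_surjective (Submonoid.powers t) x
  rw [IsLocalRing.residue_eq_zero_iff]
  have hwp : (w : B) ∉ p := by
    obtain ⟨n, hn⟩ := (Submonoid.mem_powers_iff _ _).mp w.2
    rw [← hn]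
    exact fun h => ht (‹p.IsPrime›.mem_of_pow_mem n h)
  have hw : IsUnit (algebraMap B R w) := IsLocalization.map_units R (⟨(w : B), hwp⟩ : p.primeCompl)
  have hψ : ψ (IsLocalization.mk' (Localization.Away t) b w) * algebraMap B R w =
      algebraMap B R b := by
    rw [← ψ.commutes (w : B), ← map_mul, IsLocalization.mk'_spec, AlgHom.commutes]
  change ψ (IsLocalization.mk' (Localization.Away t) b w) ∈ maximalIdeal R ↔ _
  rw [IsLocalization.mk'_mem_map_algebraMap_iff (Submonoid.powers t)]
  constructor
  · intro hm
    have hb : algebraMap B R b ∈ maximalIdeal R := by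
      rw [← hψ]
      exact Ideal.mul_mem_right _ _ hm
    rw [IsLocalization.AtPrime.to_map_mem_maximal_iff R p] at hb
    exact ⟨1, Submonoid.one_mem _, by rwa [one_mul]⟩
  · rintro ⟨s, hs, hsb⟩
    obtain ⟨n, rfl⟩ := (Submonoid.mem_powers_iff _ _).mp hs
    have hb : b ∈ p :=
      (‹p.IsPrime›.mem_or_mem hsb).resolve_left fun h => ht (‹p.IsPrime›.mem_of_pow_mem n h)
    rw [← IsLocalization.AtPrime.to_map_mem_maximal_iff R p, ← hψ] at hb
    exact (Ideal.unit_mul_mem_iff_mem _ hw).mp (by rwa [mul_comm] at hb)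

/-- **Descent of a residue-field section to `B_t/𝔭B_t`.** Let `R` be a localisation of `B` at
the prime `𝔭`, `C` a finitely generated `B`-algebra and `χ : C → κ = R/𝔪_R` a `B`-algebra map.
Then there is `t ∉ 𝔭` such that `B_t ⊗_B C` admits a `B_t`-algebra map to `B_t/𝔭B_t`
(namely the factorisation of `B_t ⊗ χ` through `B_t/𝔭B_t ↪ κ`, `t` a common denominator of
the values of `χ` on generators of `C`). [cite: StacksProject, Tag 07QZ (proof)] -/
theorem exists_away_section (C : Type u) [CommRing C] [Algebra B C] [Algebra.FiniteType B C]
    (χ : C →ₐ[B] ResidueField R) :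
    ∃ t : B, t ∉ p ∧
      Nonempty ((Localization.Away t ⊗[B] C) →ₐ[Localization.Away t]
        (Localization.Away t ⧸ p.map (algebraMap B (Localization.Away t)))) := by
  classical
  obtain ⟨s, hs⟩ := Algebra.FiniteType.out (R := B) (A := C)
  have key : ∀ c : C, ∃ (β : B) (u : p.primeCompl),
      χ c = residue R (IsLocalization.mk' R β u) := by
    intro c
    obtain ⟨r, hr⟩ := Ideal.Quotient.mk_surjective (χ c)
    obtain ⟨⟨β, u⟩, rfl⟩ := IsLocalization.mk'_surjective p.primeCompl r
    exact ⟨β, u, hr.symm⟩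
  choose β u hβu using key
  set t : B := ∏ c ∈ s, (u c : B) with ht_def
  have htmem : t ∈ p.primeCompl := prod_mem fun c _ => (u c).2
  have ht : t ∉ p := htmem
  refine ⟨t, ht, ?_⟩
  set Bt := Localization.Away t with hBt
  set pt : Ideal Bt := p.map (algebraMap B Bt) with hpt
  let ψ : Bt →ₐ[B] R := IsLocalization.Away.liftAlgHom t (f := Algebra.ofId B R)
    (IsLocalization.map_units R (⟨t, ht⟩ : p.primeCompl))
  letI : Algebra Bt (ResidueField R) := ((residue R).comp ψ.toRingHom).toAlgebra
  haveI : IsScalarTower B Bt (ResidueField R) :=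
    IsScalarTower.of_algebraMap_eq fun b => by
      change algebraMap B (ResidueField R) b = residue R (ψ (algebraMap B Bt b))
      rw [AlgHom.commutes]
      rfl
  have hker : ∀ x : Bt, algebraMap Bt (ResidueField R) x = 0 ↔ x ∈ pt := fun x =>
    residue_away_eq_zero_iff p R t ht ψ x
  -- the embedding `ιt : Bt/pt → κ`
  let ιt : (Bt ⧸ pt) →ₐ[Bt] ResidueField R :=
    Ideal.Quotient.liftₐ pt (Algebra.ofId Bt (ResidueField R)) fun x hx => (hker x).mpr hx
  have hιt : Function.Injective ιt := by
    rw [injective_iff_map_eq_zero]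
    intro x hx
    obtain ⟨x, rfl⟩ := Ideal.Quotient.mk_surjective x
    rw [Ideal.Quotient.eq_zero_iff_mem, ← hker x]
    exact hx
  -- every value of `χ` lies in the image of `ιt`
  let T : Subalgebra Bt (ResidueField R) := ιt.range
  have hgen : ∀ c ∈ s, χ c ∈ T := by
    intro c hc
    obtain ⟨v, hv⟩ : (u c : B) ∣ t := Finset.dvd_prod_of_mem (fun c => (u c : B)) hc
    refine ⟨Ideal.Quotient.mk pt
      (IsLocalization.mk' Bt (β c * v) ⟨t, Submonoid.mem_powers t⟩), ?_⟩
    change residue R (ψ (IsLocalization.mk' Bt (β c * v) ⟨t, Submonoid.mem_powers t⟩)) = χ c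
    rw [hβu c]
    congr 1
    have h1 : ψ (IsLocalization.mk' Bt (β c * v) ⟨t, Submonoid.mem_powers t⟩) *
        algebraMap B R t = algebraMap B R (β c * v) := by
      rw [← ψ.commutes t, ← map_mul]
      erw [IsLocalization.mk'_spec]
      exact ψ.commutes _
    have h2 : IsLocalization.mk' R (β c) (u c) * algebraMap B R t = algebraMap B R (β c * v) := by
      rw [hv, map_mul, ← mul_assoc, IsLocalization.mk'_spec, map_mul]
    exact (IsLocalization.map_units R (⟨t, ht⟩ : p.primeCompl)).mul_left_injective (h1.trans h2.symm)
  have hχT : ∀ c : C, χ c ∈ T := by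
    have hle : χ.range ≤ T.restrictScalars B := by
      rw [← Algebra.map_top, ← hs, AlgHom.map_adjoin, Algebra.adjoin_le_iff]
      rintro _ ⟨c, hc, rfl⟩
      exact hgen c hc
    intro c
    exact hle ⟨c, rfl⟩
  -- `Bt ⊗ χ` lands in `T`
  let χt : (Bt ⊗[B] C) →ₐ[Bt] ResidueField R :=
    Algebra.TensorProduct.lift (Algebra.ofId Bt (ResidueField R)) χ fun _ _ => Commute.all _ _
  have hχt : ∀ x, χt x ∈ T := by
    intro x
    induction x using TensorProduct.induction_on with
    | zero => rw [map_zero]; exact T.zero_mem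
    | tmul a c =>
      change Algebra.TensorProduct.lift _ _ _ (a ⊗ₜ c) ∈ T
      rw [Algebra.TensorProduct.lift_tmul]
      exact T.mul_mem (T.algebraMap_mem a) (hχT c)
    | add x y hx hy => rw [map_add]; exact T.add_mem hx hy
  exact ⟨((AlgEquiv.ofInjective ιt hιt).symm.toAlgHom).comp (χt.codRestrict T hχt)⟩

end AwaySection


end Literature.AlgebraicGeometry.Resolution

end
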